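import Literature.NumberTheory.DiophantineGeometry.BelyiTransport
import HarnessLib

/-!
# Belyi degrees under a change of the constant field (semilinear transport)

Topic `NumberTheory/DiophantineGeometry`; sequel to `BelyiTransport.lean` (transport of
`IsBelyiFunction` / `belyiDegree` along `K`-isomorphisms) in the orbit of the named fact
`javanpeykar2014_stableFaltingsHeight_le` of `BelyiDegreeFaltingsHeight.lean`, whose right-hand side
`deg_B(E_Ω)` is formed with an *arbitrary* algebraic closure `Ω` of the number field `K`. Here the
transport is along a pair of isomorphisms `φ : k ≃ k'` of constant fields and `e : F ≃ F'` of
function fields with `e ∘ algebraMap = algebraMap ∘ φ`: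

* `PlaceOver.mapRingEquiv φ e he P` (the valuation ring `e(𝒪_P)`), `ord_mapRingEquiv`;
* `IsBelyiFunction.map_ringEquiv`, `finrank_adjoin_map_ringEquiv` (`[F' : k'(e f)] = [F : k(f)]`),
  **`belyiDegree_eq_of_ringEquiv`**: `deg_B(F/k) = deg_B(F'/k')`;
* for Weierstrass curves: `WeierstrassFunctionField.coordinateRingEquivOfRingEquiv`,
  `functionFieldEquivOfRingEquiv φ V : k(V) ≃+* k'(φV)` and
  `belyiDegree_functionField_map_eq`;
* **`belyiDegree_baseChange_eq_of_isAlgClosure`**: for an elliptic curve `E/K` and two algebraic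
  closures `Ω, Ω'` of `K`, `deg_B(E_Ω) = deg_B(E_{Ω'})`; in particular `deg_B(E_Ω) = deg_B(K̄(E))`
  for `K̄ = AlgebraicClosure K` (`belyiDegree_baseChange_eq_geom`), so that results proved for
  `K̄(E)` with the `EllipticCurves` machinery (e.g. `deg_B = 3 ↔ j = 0` of `BelyiDegreeThreeJZero`)
  transfer to the quantity `deg_B(E_Ω)` of the named fact verbatim.

## References

* A. Javanpeykar, *Polynomial bounds for Arakelov invariants of Belyi curves*, Algebra & Number
  Theory 8 (2014), §1.1, Thm. 1.1.1. [Javanpeykar2014]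
* H. Stichtenoth, *Algebraic Function Fields and Codes*, 2nd ed., GTM 254, Springer 2009,
  Lemma 3.5.2. [Stichtenoth2009]
-/

noncomputable section

namespace Literature.NumberTheory.DiophantineGeometry.AlgFunctionField

open scoped IntermediateField

universe u v u' v'

section Semilinear

variable {k : Type u} {F : Type v} {k' : Type u'} {F' : Type v'} [Field k] [Field F] [Algebra k F]
  [Field k'] [Field F'] [Algebra k' F']

/-- The compatibility `e ∘ algebraMap = algebraMap ∘ φ` read backwards. [folklore] -/
theorem symm_algebraMap_of_compat (φ : k ≃+* k') (e : F ≃+* F')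
    (he : ∀ c : k, e (algebraMap k F c) = algebraMap k' F' (φ c)) (c' : k') :
    e.symm (algebraMap k' F' c') = algebraMap k F (φ.symm c') := by
  apply e.injective
  rw [e.apply_symm_apply, he, φ.apply_symm_apply]

namespace PlaceOver

variable [IsAlgFunctionField k' F']

/-- **Transport of a place along a semilinear isomorphism** `(φ, e) : (k, F) ≃ (k', F')`: the
valuation ring `e(𝒪_P)`. [folklore] -/
def mapRingEquiv (φ : k ≃+* k') (e : F ≃+* F')
    (he : ∀ c : k, e (algebraMap k F c) = algebraMap k' F' (φ c)) (P : PlaceOver k F) :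
    PlaceOver k' F' where
  toValuationSubring := P.toValuationSubring.comap (e.symm : F' →+* F)
  ne_top := by
    intro h
    apply P.ne_top
    refine top_unique fun x _ ↦ ?_
    have : e x ∈ P.toValuationSubring.comap (e.symm : F' →+* F) := h ▸ ValuationSubring.mem_top _
    simpa using this
  isDVR := by
    refine IsAlgFunctionField.isDiscreteValuationRing_of_ne_top_of_algebraMap_mem (K := k') _ ?_ ?_
    · intro h
      apply P.ne_top
      refine top_unique fun x _ ↦ ?_
      have : e x ∈ P.toValuationSubring.comap (e.symm : F' →+* F) := h ▸ ValuationSubring.mem_top _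
      simpa using this
    · intro c'
      change e.symm (algebraMap k' F' c') ∈ P.toValuationSubring
      rw [symm_algebraMap_of_compat φ e he]
      exact P.algebraMap_mem _
  algebraMap_mem c' := by
    change e.symm (algebraMap k' F' c') ∈ P.toValuationSubring
    rw [symm_algebraMap_of_compat φ e he]
    exact P.algebraMap_mem _

/-- Membership in the transported place (definitional). [folklore] -/
theorem mem_mapRingEquiv_iff (φ : k ≃+* k') (e : F ≃+* F')
    (he : ∀ c : k, e (algebraMap k F c) = algebraMap k' F' (φ c)) (P : PlaceOver k F) (y : F') :
    y ∈ (P.mapRingEquiv φ e he).toValuationSubring ↔ e.symm y ∈ P.toValuationSubring :=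
  Iff.rfl

/-- `e⁻¹` maps a uniformizer of `e(P)` to a uniformizer of `P`. [folklore] -/
theorem ord_symm_uniformizer_mapRingEquiv (φ : k ≃+* k') (e : F ≃+* F')
    (he : ∀ c : k, e (algebraMap k F c) = algebraMap k' F' (φ c)) (P : PlaceOver k F) :
    P.ord (e.symm ((P.mapRingEquiv φ e he).uniformizer : F')) = 1 := by
  let eqv : (P.mapRingEquiv φ e he).toValuationSubring ≃* P.toValuationSubring :=
    { toFun := fun y ↦ ⟨e.symm (y : F'), y.2⟩
      invFun := fun y ↦ ⟨e (y : F), by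
        change e.symm (e (y : F)) ∈ P.toValuationSubring
        rw [RingEquiv.symm_apply_apply]; exact y.2⟩
      left_inv := fun y ↦ Subtype.ext (e.apply_symm_apply (y : F'))
      right_inv := fun y ↦ Subtype.ext (e.symm_apply_apply (y : F))
      map_mul' := fun y z ↦ Subtype.ext (map_mul e.symm (y : F') z) }
  have hirr : Irreducible (eqv (P.mapRingEquiv φ e he).uniformizer) :=
    (MulEquiv.irreducible_iff eqv).2 (P.mapRingEquiv φ e he).irreducible_uniformizer
  have hmem : e.symm ((P.mapRingEquiv φ e he).uniformizer : F') ∈ P.toValuationSubring :=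
    ((P.mapRingEquiv φ e he).uniformizer).2
  rw [P.ord_of_mem hmem]
  have : (⟨e.symm ((P.mapRingEquiv φ e he).uniformizer : F'), hmem⟩ : P.toValuationSubring) =
      eqv (P.mapRingEquiv φ e he).uniformizer := rfl
  rw [this, IsDiscreteValuationRing.addVal_uniformizer hirr]
  rfl

/-- **`ord_{e(P)}(y) = ord_P(e⁻¹ y)`** (valuations are transported by isomorphisms).
[cite: Stichtenoth2009, Lemma 3.5.2] -/
theorem ord_mapRingEquiv (φ : k ≃+* k') (e : F ≃+* F')
    (he : ∀ c : k, e (algebraMap k F c) = algebraMap k' F' (φ c)) (P : PlaceOver k F) (y : F') :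
    (P.mapRingEquiv φ e he).ord y = P.ord (e.symm y) := by
  rcases eq_or_ne y 0 with rfl | hy
  · rw [map_zero, PlaceOver.ord_zero, PlaceOver.ord_zero]
  set P' := P.mapRingEquiv φ e he with hP'
  set m : ℤ := P'.ord y with hm
  set π' : F' := (P'.uniformizer : F') with hπ'
  have hπ'0 : π' ≠ 0 := P'.coe_uniformizer_ne_zero
  have hσπ0 : e.symm π' ≠ 0 := (_root_.map_ne_zero e.symm).2 hπ'0
  set u : F' := y * π' ^ (-m) with hu
  have hu0 : u ≠ 0 := mul_ne_zero hy (zpow_ne_zero _ hπ'0)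
  have hπ'1 : P'.ord π' = 1 := by simpa using P'.ord_uniformizer_zpow 1
  have hordu : P'.ord u = 0 := by
    rw [hu, P'.ord_mul_eq hy (zpow_ne_zero _ hπ'0), P'.ord_zpow hπ'0, hπ'1, ← hm]
    ring
  have huO : u ∈ P'.toValuationSubring := (P'.mem_toValuationSubring_iff_ord_nonneg hu0).2 hordu.ge
  have huiO : u⁻¹ ∈ P'.toValuationSubring :=
    (P'.mem_toValuationSubring_iff_ord_nonneg (inv_ne_zero hu0)).2 (by rw [P'.ord_inv hu0]; omega)
  have hσu : e.symm u ∈ P.toValuationSubring := huO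
  have hσui : (e.symm u)⁻¹ ∈ P.toValuationSubring := by rw [← map_inv₀]; exact huiO
  have hσu0 : e.symm u ≠ 0 := (_root_.map_ne_zero e.symm).2 hu0
  have hordσu : P.ord (e.symm u) = 0 := by
    have h1 := P.ord_nonneg_of_mem hσu
    have h2 := P.ord_nonneg_of_mem hσui
    rw [P.ord_inv hσu0] at h2
    omega
  have hy' : e.symm y = e.symm u * e.symm π' ^ m := by
    rw [hu, map_mul, map_zpow₀, mul_assoc, ← zpow_add₀ hσπ0, neg_add_cancel, zpow_zero, mul_one]
  rw [hy', P.ord_mul_eq hσu0 (zpow_ne_zero _ hσπ0), hordσu, P.ord_zpow hσπ0,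
    ord_symm_uniformizer_mapRingEquiv, zero_add, mul_one]

end PlaceOver

/-! ### Belyi functions and degrees -/

section

variable [IsAlgFunctionField k F] [IsAlgFunctionField k' F']

omit [IsAlgFunctionField k' F'] in
/-- **Belyi functions are transported**: `f` Belyi for `F/k` ⇒ `e f` Belyi for `F'/k'`.
[cite: Javanpeykar2014, §1.1] -/
theorem IsBelyiFunction.map_ringEquiv (φ : k ≃+* k') (e : F ≃+* F')
    (he : ∀ c : k, e (algebraMap k F c) = algebraMap k' F' (φ c)) {f : F}
    (h : IsBelyiFunction k f) : IsBelyiFunction k' (e f) := by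
  have he' := symm_algebraMap_of_compat φ e he
  refine ⟨?_, fun c' hc0 hc1 P' hP' ↦ ?_⟩
  · rintro ⟨c', hc'⟩
    exact h.1 ⟨φ.symm c', by rw [← he', hc', RingEquiv.symm_apply_apply]⟩
  · -- pull the place `P'` of `F'` back to `F`
    have key : e f - algebraMap k' F' c' = e (f - algebraMap k F (φ.symm c')) := by
      rw [map_sub, he, φ.apply_symm_apply]
    have hord : P'.ord (e f - algebraMap k' F' c') =
        (P'.mapRingEquiv φ.symm e.symm he').ord (f - algebraMap k F (φ.symm c')) := by
      rw [PlaceOver.ord_mapRingEquiv, key]; rfl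
    rw [hord] at hP' ⊢
    exact h.2 (φ.symm c') (by simpa using hc0) (fun h1 ↦ hc1 (by simpa using congr_arg φ h1)) _
      hP'

omit [IsAlgFunctionField k F] [IsAlgFunctionField k' F'] in
/-- `e` maps `k(f)` into `k'(e f)`. [folklore] -/
theorem map_mem_adjoin_of_mem (φ : k ≃+* k') (e : F ≃+* F')
    (he : ∀ c : k, e (algebraMap k F c) = algebraMap k' F' (φ c)) (f : F) {x : F} (hx : x ∈ k⟮f⟯) :
    e x ∈ k'⟮e f⟯ := by
  have hle : k⟮f⟯.toSubfield ≤ (k'⟮e f⟯.toSubfield).comap (e : F →+* F') := by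
    rw [IntermediateField.adjoin_toSubfield, Subfield.closure_le]
    rintro y (⟨c, rfl⟩ | hy)
    · change e (algebraMap k F c) ∈ k'⟮e f⟯.toSubfield
      rw [he]; exact (k'⟮e f⟯).algebraMap_mem (φ c)
    · rw [Set.mem_singleton_iff] at hy
      subst hy
      exact IntermediateField.mem_adjoin_simple_self k' (e y)
  exact hle ((IntermediateField.mem_toSubfield _ _).2 hx)

omit [IsAlgFunctionField k F] [IsAlgFunctionField k' F'] in
/-- **Degrees are transported**: `[F' : k'(e f)] = [F : k(f)]` (`e` restricts to `k(f) ≃ k'(e f)`).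
[folklore] -/
theorem finrank_adjoin_map_ringEquiv (φ : k ≃+* k') (e : F ≃+* F')
    (he : ∀ c : k, e (algebraMap k F c) = algebraMap k' F' (φ c)) (f : F) :
    Module.finrank k'⟮e f⟯ F' = Module.finrank k⟮f⟯ F := by
  have he' := symm_algebraMap_of_compat φ e he
  have hback : ∀ {y : F'}, y ∈ k'⟮e f⟯ → e.symm y ∈ k⟮f⟯ := fun {y} hy ↦ by
    have h := map_mem_adjoin_of_mem φ.symm e.symm he' (e f) hy
    rwa [RingEquiv.symm_apply_apply] at h
  let i : k⟮f⟯ ≃+* k'⟮e f⟯ :=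
    { toFun := fun x ↦ ⟨e x, map_mem_adjoin_of_mem φ e he f x.2⟩
      invFun := fun y ↦ ⟨e.symm y, hback y.2⟩
      left_inv := fun x ↦ Subtype.ext (e.symm_apply_apply (x : F))
      right_inv := fun y ↦ Subtype.ext (e.apply_symm_apply (y : F'))
      map_mul' := fun x y ↦ Subtype.ext (map_mul e (x : F) y)
      map_add' := fun x y ↦ Subtype.ext (map_add e (x : F) y) }
  symm
  refine Algebra.finrank_eq_of_equiv_equiv i e ?_
  ext x
  rfl

/-- **The Belyi degree is transported along semilinear isomorphisms**: `deg_B(F/k) = deg_B(F'/k')`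
for `(φ, e) : (k, F) ≃ (k', F')`. [cite: Javanpeykar2014, §1.1] -/
theorem belyiDegree_eq_of_ringEquiv (φ : k ≃+* k') (e : F ≃+* F')
    (he : ∀ c : k, e (algebraMap k F c) = algebraMap k' F' (φ c)) :
    belyiDegree k F = belyiDegree k' F' := by
  have he' := symm_algebraMap_of_compat φ e he
  unfold belyiDegree
  congr 1
  ext n
  constructor
  · rintro ⟨f, hf, rfl⟩
    exact ⟨e f, hf.map_ringEquiv φ e he, finrank_adjoin_map_ringEquiv φ e he f⟩
  · rintro ⟨f', hf', rfl⟩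
    refine ⟨e.symm f', hf'.map_ringEquiv φ.symm e.symm he', ?_⟩
    exact finrank_adjoin_map_ringEquiv φ.symm e.symm he' f'

end

end Semilinear

end Literature.NumberTheory.DiophantineGeometry.AlgFunctionField

/-! ### Weierstrass curves: `k(V) ≃ k'(φV)` along an isomorphism of base fields -/

namespace Literature.NumberTheory.DiophantineGeometry.WeierstrassBelyi

open Polynomial WeierstrassCurve AlgFunctionField

universe u u'

variable {k : Type u} {k' : Type u'} [Field k] [Field k'] (φ : k ≃+* k') (V : WeierstrassCurve k)

/-- Mathlib's `CoordinateRing.map` along an isomorphism `φ : k ≃ k'` of base fields is surjective.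
[folklore] -/
theorem coordinateRing_map_surjective :
    Function.Surjective (Affine.CoordinateRing.map V.toAffine (φ : k →+* k')) := by
  intro y
  obtain ⟨q, rfl⟩ := AdjoinRoot.mk_surjective y
  refine ⟨Affine.CoordinateRing.mk V.toAffine (q.map (mapRingHom (φ.symm : k' →+* k))), ?_⟩
  rw [Affine.CoordinateRing.map_mk, Polynomial.map_map, Polynomial.mapRingHom_comp,
    show (φ : k →+* k').comp (φ.symm : k' →+* k) = RingHom.id k' from
      RingHom.ext fun c ↦ φ.apply_symm_apply c, Polynomial.mapRingHom_id, Polynomial.map_id]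

/-- **`k[V] ≃ k'[φV]`**: the coordinate rings along an isomorphism of base fields (Mathlib's
`CoordinateRing.map`, bijective). [folklore] -/
def coordinateRingEquivOfRingEquiv :
    V.toAffine.CoordinateRing ≃+* (V.map (φ : k →+* k')).toAffine.CoordinateRing :=
  RingEquiv.ofBijective (Affine.CoordinateRing.map V.toAffine (φ : k →+* k'))
    ⟨Affine.CoordinateRing.map_injective φ.injective, coordinateRing_map_surjective φ V⟩

/-- `coordinateRingEquivOfRingEquiv` acts as `CoordinateRing.map`. [folklore] -/
theorem coordinateRingEquivOfRingEquiv_apply (r : V.toAffine.CoordinateRing) :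
    coordinateRingEquivOfRingEquiv φ V r = Affine.CoordinateRing.map V.toAffine (φ : k →+* k') r :=
  rfl

/-- Constants go to constants: `k → k[V] → k'[φV]` is `φ` followed by `k' → k'[φV]`. [folklore] -/
theorem coordinateRing_map_algebraMap (c : k) :
    Affine.CoordinateRing.map V.toAffine (φ : k →+* k') (algebraMap k V.toAffine.CoordinateRing c) =
      algebraMap k' (V.map (φ : k →+* k')).toAffine.CoordinateRing (φ c) := by
  rw [IsScalarTower.algebraMap_apply k k[X] V.toAffine.CoordinateRing,
    IsScalarTower.algebraMap_apply k' k'[X] (V.map (φ : k →+* k')).toAffine.CoordinateRing,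
    Polynomial.algebraMap_eq, Polynomial.algebraMap_eq]
  change Affine.CoordinateRing.map V.toAffine (φ : k →+* k')
      (Affine.CoordinateRing.mk _ (C (C c))) = Affine.CoordinateRing.mk _ (C (C (φ c)))
  rw [Affine.CoordinateRing.map_mk, Polynomial.map_C, coe_mapRingHom, Polynomial.map_C]
  rfl

/-- **`k(V) ≃ k'(φV)`: the function fields along an isomorphism `φ` of base fields** (the
fraction fields of `k[V] ≃ k'[φV]`). [folklore] -/
def functionFieldEquivOfRingEquiv :
    V.toAffine.FunctionField ≃+* (V.map (φ : k →+* k')).toAffine.FunctionField :=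
  IsFractionRing.ringEquivOfRingEquiv (coordinateRingEquivOfRingEquiv φ V)

/-- `functionFieldEquivOfRingEquiv` is `φ` on constants. [folklore] -/
theorem functionFieldEquivOfRingEquiv_algebraMap (c : k) :
    functionFieldEquivOfRingEquiv φ V (algebraMap k V.toAffine.FunctionField c) =
      algebraMap k' (V.map (φ : k →+* k')).toAffine.FunctionField (φ c) := by
  rw [IsScalarTower.algebraMap_apply k V.toAffine.CoordinateRing V.toAffine.FunctionField,
    functionFieldEquivOfRingEquiv, IsFractionRing.ringEquivOfRingEquiv_algebraMap,
    coordinateRingEquivOfRingEquiv_apply, coordinateRing_map_algebraMap,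
    ← IsScalarTower.algebraMap_apply]

/-- **`deg_B(k(V)/k) = deg_B(k'(φV)/k')`**: the Belyi degree of the function field of a Weierstrass
curve is unchanged under an isomorphism of the (algebraically closed, or any) base field applied to
the coefficients. [cite: Javanpeykar2014, §1.1] -/
theorem belyiDegree_functionField_map_eq [IsAlgFunctionField k V.toAffine.FunctionField]
    [IsAlgFunctionField k' (V.map (φ : k →+* k')).toAffine.FunctionField] :
    belyiDegree k V.toAffine.FunctionField =
      belyiDegree k' (V.map (φ : k →+* k')).toAffine.FunctionField :=
  belyiDegree_eq_of_ringEquiv φ (functionFieldEquivOfRingEquiv φ V)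
    (functionFieldEquivOfRingEquiv_algebraMap φ V)

end Literature.NumberTheory.DiophantineGeometry.WeierstrassBelyi

/-! ### The setting of the named fact: independence of the algebraic closure -/

namespace Literature.NumberTheory.DiophantineGeometry

open WeierstrassCurve AlgFunctionField

/-- **`deg_B(E_Ω) = deg_B(E_{Ω'})` for any two algebraic closures `Ω, Ω'` of `K`**: the quantity
`belyiDegree Ω (Ω(E))` in `javanpeykar2014_stableFaltingsHeight_le` does not depend on the choice
of the algebraic closure (`Ω ≃ₐ[K] Ω'`, Mathlib's `IsAlgClosure.equiv`, and
`belyiDegree_functionField_map_eq`). [cite: Javanpeykar2014, Thm. 1.1.1] -/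
theorem belyiDegree_baseChange_eq_of_isAlgClosure (K : Type) [Field K] (W : WeierstrassCurve K)
    [W.IsElliptic] (Ω : Type) [Field Ω] [Algebra K Ω] [IsAlgClosure K Ω] (Ω' : Type) [Field Ω']
    [Algebra K Ω'] [IsAlgClosure K Ω'] :
    belyiDegree Ω (W.baseChange Ω).toAffine.FunctionField =
      belyiDegree Ω' (W.baseChange Ω').toAffine.FunctionField := by
  haveI : (W.baseChange Ω).IsElliptic := by rw [WeierstrassCurve.baseChange]; infer_instance
  haveI : (W.baseChange Ω').IsElliptic := by rw [WeierstrassCurve.baseChange]; infer_instance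
  set φ : Ω ≃ₐ[K] Ω' := IsAlgClosure.equiv K Ω Ω' with hφ
  have hmap : (W.baseChange Ω).map ((φ : Ω ≃+* Ω') : Ω →+* Ω') = W.baseChange Ω' := by
    rw [show ((φ : Ω ≃+* Ω') : Ω →+* Ω') = ((φ : Ω →ₐ[K] Ω') : Ω →+* Ω') from
      RingHom.ext fun _ ↦ rfl]
    exact W.map_baseChange (φ : Ω →ₐ[K] Ω')
  haveI : ((W.baseChange Ω).map ((φ : Ω ≃+* Ω') : Ω →+* Ω')).IsElliptic := by
    rw [hmap]; infer_instance
  have h := WeierstrassBelyi.belyiDegree_functionField_map_eq (φ : Ω ≃+* Ω') (W.baseChange Ω)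
  rw [hmap] at h
  exact h

/-- In particular **`deg_B(E_Ω) = deg_B(K̄(E))`** with `K̄ = AlgebraicClosure K` (the right-hand
side is `belyiDegree (AlgebraicClosure K) W.geomFunctionField` of the `EllipticCurves` files,
`WeierstrassCurve.geomFunctionField` being this very `abbrev`).
[cite: Javanpeykar2014, Thm. 1.1.1] -/
theorem belyiDegree_baseChange_eq_geom (K : Type) [Field K] (W : WeierstrassCurve K) [W.IsElliptic]
    (Ω : Type) [Field Ω] [Algebra K Ω] [IsAlgClosure K Ω] :
    belyiDegree Ω (W.baseChange Ω).toAffine.FunctionField =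
      belyiDegree (AlgebraicClosure K) (W.baseChange (AlgebraicClosure K)).toAffine.FunctionField :=
  belyiDegree_baseChange_eq_of_isAlgClosure K W Ω (AlgebraicClosure K)

end Literature.NumberTheory.DiophantineGeometry

end
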